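import Mathlib

/-!
# Negative lemma for line `jl-zero-cycle-height` (crux stmt-ABC-1561, `ManyPrimeValuationProduct`):
# the Néron-period condition is load-bearing in `stub_zeroCycleHeight`

`ZeroCycleHeight` (skeleton `Cruxes/ManyPrimeValuationProduct/Lines/jl-zero-cycle-height.lean`) asks, for
every admissible Shimura datum `(S, F)` and every NON-ZERO weight-2 form `s` on `S.Gamma` WITH PERIODS IN
THE NÉRON LATTICE, `mean_F log ‖s‖²_pt ≥ −(ε log N + C)`, where `‖s‖²_pt(z) = |s(z)|² (Im z)²` is the
skeleton's `pet s z` (written out below, so that the lemmas apply to it by `rfl`). This file records,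
sorry-free, why the period condition cannot be dropped or weakened to any scale-invariant condition: the
geometric mean of `‖s‖²_pt` is not bounded below on the real ray `c • s`, `c → 0⁺` —
`mean_F log ‖c • s‖²_pt = 2 log c + mean_F log ‖s‖²_pt` (`mean_log_pet_smul`) — so on ANY `(Γ, F)` of
finite positive covolume carrying one form with `log ‖s‖²_pt ∈ L¹(F)` and `‖s‖_pt > 0` a.e. (exactly the
side conditions `stub_jlPackage` supplies) there is no constant `C` with `−C ≤ mean_F log ‖s‖²_pt` for
all non-zero `s` (`not_exists_uniform_mean_log_lower_bound`): `stub_zeroCycleHeight` with `HasPeriodsIn`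
dropped is false at every inhabited datum, already for one fixed curve. Any proof of the stub must use
`HasPeriodsIn S.Gamma s Λ_E` quantitatively (it is the only normalisation of `s` in the statement); and
since multiples `c • s`, `c ≥ 1`, only raise the mean (`mean_log_pet_le_smul`), the stub is exactly the
statement for the primitive forms of the period lattice.
-/

set_option linter.dupNamespace false

noncomputable section

open MeasureTheory
open scoped MatrixGroups

namespace Summit.ABC.ABC.Theorems.ManyPrimeValuationProduct.Negative.JlScaling

variable {Γ : Subgroup (GL (Fin 2) ℝ)} {F : Set UpperHalfPlane}

/-- `‖c • s‖²_pt = c² ‖s‖²_pt` for a real scalar `c` (real scalars act on `CuspForm Γ 2` for every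
`Γ ≤ GL₂(ℝ)`, Mathlib `CuspForm.instSMul`). [folklore] -/
theorem pet_smul (c : ℝ) (s : CuspForm Γ 2) (z : UpperHalfPlane) :
    ‖(c • s) z‖ ^ 2 * z.im ^ 2 = c ^ 2 * (‖s z‖ ^ 2 * z.im ^ 2) := by
  simp only [CuspForm.smul_apply, Complex.real_smul, norm_mul, Complex.norm_real,
    Real.norm_eq_abs, mul_pow, sq_abs]
  ring

/-- A form that is `‖·‖_pt`-positive a.e. on a set of non-zero measure is non-zero, and so are its
non-zero real multiples. [folklore] -/
theorem smul_ne_zero_of_ae_pos (hF0 : volume F ≠ 0) (s : CuspForm Γ 2)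
    (hpos : ∀ᵐ z ∂(volume.restrict F), 0 < ‖s z‖ ^ 2 * z.im ^ 2) {c : ℝ} (hc : c ≠ 0) :
    c • s ≠ 0 := by
  intro h
  have hae : ∀ᵐ z ∂(volume.restrict F), False := by
    filter_upwards [hpos] with z hz
    have h1 : ‖(c • s) z‖ ^ 2 * z.im ^ 2 = 0 := by simp [h]
    rw [pet_smul] at h1
    rcases mul_eq_zero.mp h1 with h2 | h2
    · exact hc (pow_eq_zero_iff (two_ne_zero) |>.mp h2)
    · exact (ne_of_gt hz) h2
  rw [Filter.eventually_false_iff_eq_bot, ae_eq_bot, Measure.restrict_eq_zero] at hae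
  exact hF0 hae

/-- **Scaling law.** For `c > 0`: `log ‖c • s‖²_pt` is integrable on `F` and
`mean_F log ‖c • s‖²_pt = 2 log c + mean_F log ‖s‖²_pt` (given `0 < vol F < ∞`, `log ‖s‖²_pt ∈ L¹(F)`,
`‖s‖_pt > 0` a.e. on `F`). [folklore] -/
theorem mean_log_pet_smul (hF0 : volume F ≠ 0) (hFtop : volume F ≠ ⊤) (s : CuspForm Γ 2)
    (hint : IntegrableOn (fun z => Real.log (‖s z‖ ^ 2 * z.im ^ 2)) F)
    (hpos : ∀ᵐ z ∂(volume.restrict F), 0 < ‖s z‖ ^ 2 * z.im ^ 2) {c : ℝ} (hc : 0 < c) :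
    IntegrableOn (fun z => Real.log (‖(c • s) z‖ ^ 2 * z.im ^ 2)) F ∧
      (volume F).toReal⁻¹ * ∫ z in F, Real.log (‖(c • s) z‖ ^ 2 * z.im ^ 2) =
        2 * Real.log c + (volume F).toReal⁻¹ * ∫ z in F, Real.log (‖s z‖ ^ 2 * z.im ^ 2) := by
  haveI : IsFiniteMeasure (volume.restrict F) :=
    ⟨by rwa [Measure.restrict_apply_univ, lt_top_iff_ne_top]⟩
  have hVpos : 0 < (volume F).toReal := ENNReal.toReal_pos hF0 hFtop
  -- a.e. on F: log ‖c•s‖² = 2 log c + log ‖s‖²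
  have hae : (fun z => Real.log (‖(c • s) z‖ ^ 2 * z.im ^ 2)) =ᵐ[volume.restrict F]
      fun z => 2 * Real.log c + Real.log (‖s z‖ ^ 2 * z.im ^ 2) := by
    filter_upwards [hpos] with z hz
    rw [pet_smul, Real.log_mul (pow_ne_zero 2 hc.ne') hz.ne', Real.log_pow]
    push_cast
    ring
  have hint' : IntegrableOn (fun z => 2 * Real.log c + Real.log (‖s z‖ ^ 2 * z.im ^ 2)) F :=
    (integrable_const _).add hint
  refine ⟨hint'.congr hae.symm, ?_⟩
  rw [integral_congr_ae hae]
  change (volume F).toReal⁻¹ * ∫ z in F, (2 * Real.log c + Real.log (‖s z‖ ^ 2 * z.im ^ 2)) = _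
  rw [integral_add (integrable_const _) hint, integral_const, measureReal_restrict_apply_univ,
    measureReal_def, smul_eq_mul, mul_add, ← mul_assoc, inv_mul_cancel₀ hVpos.ne', one_mul]

/-- **The geometric mean of `‖s‖²_pt` is unbounded below on the ray `c • s`.** For every `B` there is
`c > 0` with `c • s ≠ 0`, `log ‖c • s‖²_pt ∈ L¹(F)`, `‖c • s‖_pt > 0` a.e., and
`mean_F log ‖c • s‖²_pt < B`. [folklore] -/
theorem exists_smul_mean_log_pet_lt (hF0 : volume F ≠ 0) (hFtop : volume F ≠ ⊤) (s : CuspForm Γ 2)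
    (hint : IntegrableOn (fun z => Real.log (‖s z‖ ^ 2 * z.im ^ 2)) F)
    (hpos : ∀ᵐ z ∂(volume.restrict F), 0 < ‖s z‖ ^ 2 * z.im ^ 2) (B : ℝ) :
    ∃ c : ℝ, 0 < c ∧ c • s ≠ 0 ∧ IntegrableOn (fun z => Real.log (‖(c • s) z‖ ^ 2 * z.im ^ 2)) F ∧
      (∀ᵐ z ∂(volume.restrict F), 0 < ‖(c • s) z‖ ^ 2 * z.im ^ 2) ∧
      (volume F).toReal⁻¹ * ∫ z in F, Real.log (‖(c • s) z‖ ^ 2 * z.im ^ 2) < B := by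
  set m : ℝ := (volume F).toReal⁻¹ * ∫ z in F, Real.log (‖s z‖ ^ 2 * z.im ^ 2)
  set c : ℝ := Real.exp ((B - m - 1) / 2) with hcdef
  have hc : 0 < c := Real.exp_pos _
  obtain ⟨hint', hmean⟩ := mean_log_pet_smul hF0 hFtop s hint hpos hc
  refine ⟨c, hc, smul_ne_zero_of_ae_pos hF0 s hpos hc.ne', hint', ?_, ?_⟩
  · filter_upwards [hpos] with z hz
    rw [pet_smul]
    positivity
  · rw [hmean, hcdef, Real.log_exp]
    linarith

/-- **No uniform lower bound without the period condition.** On any `(Γ, F)` with `0 < vol F < ∞`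
carrying one weight-2 form `s` with `log ‖s‖²_pt ∈ L¹(F)` and `‖s‖_pt > 0` a.e. (the side conditions the
package `stub_jlPackage` delivers), there is NO constant `C` with `−C ≤ mean_F log ‖s‖²_pt` for all
non-zero forms `s` with `log ‖s‖²_pt ∈ L¹(F)`: `stub_zeroCycleHeight` with `HasPeriodsIn` dropped is false
at every inhabited Shimura datum, for every fixed curve (no uniformity in `N` is even needed). [folklore] -/
theorem not_exists_uniform_mean_log_lower_bound (hF0 : volume F ≠ 0) (hFtop : volume F ≠ ⊤)
    (h : ∃ s : CuspForm Γ 2, IntegrableOn (fun z => Real.log (‖s z‖ ^ 2 * z.im ^ 2)) F ∧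
      ∀ᵐ z ∂(volume.restrict F), 0 < ‖s z‖ ^ 2 * z.im ^ 2) :
    ¬ ∃ C : ℝ, ∀ s : CuspForm Γ 2, s ≠ 0 →
        IntegrableOn (fun z => Real.log (‖s z‖ ^ 2 * z.im ^ 2)) F →
        -C ≤ (volume F).toReal⁻¹ * ∫ z in F, Real.log (‖s z‖ ^ 2 * z.im ^ 2) := by
  rintro ⟨C, hC⟩
  obtain ⟨s, hint, hpos⟩ := h
  obtain ⟨c, -, hne, hint', -, hlt⟩ := exists_smul_mean_log_pet_lt hF0 hFtop s hint hpos (-C)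
  exact absurd (hC (c • s) hne hint') (not_le.mpr hlt)

/-- **Multiples `c • s`, `c ≥ 1`, only raise the geometric mean**: `mean_F log ‖s‖²_pt ≤
mean_F log ‖c • s‖²_pt`. Within the period lattice `{s : periods ⊆ Λ_E} ⊇ ℤ • s₀` the stub is therefore
hardest at a primitive form; w.l.o.g. `s` is primitive. [folklore] -/
theorem mean_log_pet_le_smul (hF0 : volume F ≠ 0) (hFtop : volume F ≠ ⊤) (s : CuspForm Γ 2)
    (hint : IntegrableOn (fun z => Real.log (‖s z‖ ^ 2 * z.im ^ 2)) F)
    (hpos : ∀ᵐ z ∂(volume.restrict F), 0 < ‖s z‖ ^ 2 * z.im ^ 2) {c : ℝ} (hc : 1 ≤ c) :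
    (volume F).toReal⁻¹ * ∫ z in F, Real.log (‖s z‖ ^ 2 * z.im ^ 2) ≤
      (volume F).toReal⁻¹ * ∫ z in F, Real.log (‖(c • s) z‖ ^ 2 * z.im ^ 2) := by
  obtain ⟨-, hmean⟩ := mean_log_pet_smul hF0 hFtop s hint hpos (lt_of_lt_of_le one_pos hc)
  rw [hmean]
  have : 0 ≤ Real.log c := Real.log_nonneg hc
  linarith

end Summit.ABC.ABC.Theorems.ManyPrimeValuationProduct.Negative.JlScaling

end
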